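import Mathlib
import Summits.MatrixMultiplication.Statement
import Summits.MatrixMultiplication.MatrixMultiplication.Theorems.GraphEquationsSystems
import Summits.MatrixMultiplication.MatrixMultiplication.Theorems.GraphEquationsKernel
import Summits.MatrixMultiplication.MatrixMultiplication.Theorems.GraphEquationsCostRank
import Summits.MatrixMultiplication.MatrixMultiplication.Theorems.GraphEquationsWeightedTruncation
import Summits.MatrixMultiplication.MatrixMultiplication.Theorems.GraphEquationsInitialForms
import Summits.MatrixMultiplication.MatrixMultiplication.Theorems.GraphEquationsPureForms

/-!
# Reduced ⇒ pure isolated of order 2; `S ⇒ Purification` (`GraphEquations`, kernel M9b)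

Decomp-mm node «GraphEquations» (lens 5); attacked leaf `MultiplicityReduction` (`H_mult`).
Target of the node, VERBATIM: `_root_.MatrixMultiplication`.

The consistency rung of the line «initial-form rank»: the witnesses of `H_mult` (generically REDUCED
cheap systems) are witnesses of `Purification` (cheap systems with PURE ISOLATED initial forms of
bounded order), with order `K = 2` and LINEAR forms `P_o = Σ_q J_C(x)_{o,q} F_q`.  Hence
`EqAdmissibleRed β → EqAdmissiblePure β`, `H_mult → Purification`, `S → Purification` (NEC), and —
given the classical statement `IsolatedForcesRank` — `Purification ↔ H_mult` and the re-typed split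
`S ↔ V ∧ Purification` is EXACT.

The algebra behind it, proved here in full:

* `kappa` — the substitution `c_q ↦ Σ_k a_{q₁k} b_{kq₂}` (restriction to the graph as a polynomial
  map); `eval_bind₁_kappa`; a polynomial vanishing on `W_n` is killed by `kappa`
  (`bind₁_kappa_eq_zero_of_vanishing`, by `MvPolynomial.funext` over the infinite field `ℂ`);
* `sub_bind₁_kappa_mem_span` — `p − κ(p) ∈ (f_q)_q`; hence the NULLSTELLENSATZ FOR THE GRAPH in
  the explicit form `mem_span_generator_of_vanishing`: a polynomial vanishing on `W_n` lies in the
  ideal generated by the `n²` generators `f_q = c_q − Σ_k a_{q₁k} b_{kq₂}` (no radical, no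
  Hilbert: the generators are a triangular coordinate change);
* `weightedHomogeneousComponent_two_of_vanishing` — the weight-`2` component (`w(a)=w(b)=1`,
  `w(c)=2`) of a polynomial vanishing on `W_n` is `Σ_q (∂t/∂c_q-coefficient) · f_q`, via the
  product formula of M7 and `f_q` weighted-homogeneous of weight `2`;
* `EqSystem.pureIsolatedAt_two_of_reducedAt` and the admissibility / NEC corollaries.

No `sorry`.  Sources: [BurgisserClausenShokrollahi1997, Problem 16.3]; [Strassen1973].
-/

set_option linter.dupNamespace false

noncomputable section

open scoped BigOperators

namespace Summit.MatrixMultiplication.MatrixMultiplication.Theorems.GraphEquations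

open MvPolynomial
open Literature.Computability.AlgebraicComplexity

variable {n : ℕ}

/-! ## The substitution `κ : c ↦ ab` and the explicit Nullstellensatz for the graph -/

/-- `κ`: `a, b ↦ a, b`, `c_q ↦ Σ_k a_{q₁k} b_{kq₂}`. -/
def kappa (n : ℕ) : GraphVars n → MvPolynomial (GraphVars n) ℂ
  | Sum.inl v => X (Sum.inl v)
  | Sum.inr q => ∑ k : Fin n, X (Sum.inl (Sum.inl (q.1, k))) * X (Sum.inl (Sum.inr (k, q.2)))

/-- `c_q − κ(c_q) = f_q` and `a − κ(a) = 0`, uniformly. -/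
theorem X_sub_kappa (v : GraphVars n) :
    X v - kappa n v = Sum.elim (fun _ => (0 : MvPolynomial (GraphVars n) ℂ)) (generator n) v := by
  rcases v with v | q
  · simp [kappa]
  · simp [kappa, generator]

/-- Evaluating `κ(p)` at `z` = evaluating `p` at the graph point over the `(A,B)`-part of `z`. -/
theorem eval_bind₁_kappa (z : GraphVars n → ℂ) (p : MvPolynomial (GraphVars n) ℂ) :
    eval z (bind₁ (kappa n) p) = eval (graphPoint fun v => z (Sum.inl v)) p := by
  rw [show eval z (bind₁ (kappa n) p) = eval (fun v => eval z (kappa n v)) p from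
    eval₂Hom_bind₁ _ _ _ _]
  have hpt : (fun v => eval z (kappa n v)) = graphPoint fun v => z (Sum.inl v) := by
    funext v
    rcases v with v | ⟨i, l⟩
    · simp [kappa, graphPoint]
    · simp [kappa, graphPoint, map_sum]
  rw [hpt]

/-- A polynomial vanishing on the graph is killed by `κ`. -/
theorem bind₁_kappa_eq_zero_of_vanishing {t : MvPolynomial (GraphVars n) ℂ}
    (ht : ∀ y ∈ mmGraph n, eval y t = 0) : bind₁ (kappa n) t = 0 := by
  apply MvPolynomial.funext
  intro z
  rw [eval_bind₁_kappa, map_zero]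
  exact ht _ (graphPoint_mem_mmGraph _)

/-- `p − κ(p)` lies in the ideal generated by the `f_q`. -/
theorem sub_bind₁_kappa_mem_span (p : MvPolynomial (GraphVars n) ℂ) :
    p - bind₁ (kappa n) p ∈ Ideal.span (Set.range (generator n)) := by
  induction p using MvPolynomial.induction_on with
  | C r => simp
  | add p q hp hq =>
    have : p + q - bind₁ (kappa n) (p + q) =
        (p - bind₁ (kappa n) p) + (q - bind₁ (kappa n) q) := by
      simp only [map_add]; ring
    rw [this]
    exact Ideal.add_mem _ hp hq
  | mul_X p v hp =>
    have : p * X v - bind₁ (kappa n) (p * X v) =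
        (p - bind₁ (kappa n) p) * X v + bind₁ (kappa n) p * (X v - kappa n v) := by
      simp only [map_mul, bind₁_X_right]; ring
    rw [this]
    refine Ideal.add_mem _ (Ideal.mul_mem_right _ _ hp) (Ideal.mul_mem_left _ _ ?_)
    rw [X_sub_kappa]
    rcases v with v | q
    · exact Ideal.zero_mem _
    · exact Ideal.subset_span ⟨q, rfl⟩

/-- **Explicit Nullstellensatz for the graph**: a polynomial vanishing on `W_n` lies in the ideal
generated by the `n²` generators `f_q`. -/
theorem mem_span_generator_of_vanishing {t : MvPolynomial (GraphVars n) ℂ}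
    (ht : ∀ y ∈ mmGraph n, eval y t = 0) : t ∈ Ideal.span (Set.range (generator n)) := by
  have h := sub_bind₁_kappa_mem_span t
  rwa [bind₁_kappa_eq_zero_of_vanishing ht, sub_zero] at h

/-! ## Weight-2 components of polynomials vanishing on the graph -/

/-- `f_q` is weighted-homogeneous of weight `2`. -/
theorem isWeightedHomogeneous_generator (q : Fin n × Fin n) :
    IsWeightedHomogeneous (gw n) (generator n q) 2 := by
  have hX : IsWeightedHomogeneous (gw n) (X (Sum.inr q) : MvPolynomial (GraphVars n) ℂ) 2 := by
    simpa [gw] using isWeightedHomogeneous_X ℂ (gw n) (Sum.inr q : GraphVars n)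
  have hS : IsWeightedHomogeneous (gw n)
      (∑ k : Fin n, X (Sum.inl (Sum.inl (q.1, k))) * X (Sum.inl (Sum.inr (k, q.2))) :
        MvPolynomial (GraphVars n) ℂ) 2 := by
    refine IsWeightedHomogeneous.sum _ _ _ fun k _ => ?_
    have ha := isWeightedHomogeneous_X ℂ (gw n) (Sum.inl (Sum.inl (q.1, k)) : GraphVars n)
    have hb := isWeightedHomogeneous_X ℂ (gw n) (Sum.inl (Sum.inr (k, q.2)) : GraphVars n)
    simpa [gw] using ha.mul hb
  exact (weightedHomogeneousSubmodule ℂ (gw n) 2).sub_mem hX hS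

/-- The components of `f_q`. -/
theorem weightedHomogeneousComponent_generator (m : ℕ) (q : Fin n × Fin n) :
    weightedHomogeneousComponent (gw n) m (generator n q) =
      if m = 2 then generator n q else 0 := by
  classical
  exact weightedHomogeneousComponent_of_mem (isWeightedHomogeneous_generator q)

/-- The weight-`2` component of `g · f_q` is `g(0) · f_q`. -/
theorem weightedHomogeneousComponent_two_mul_generator (g : MvPolynomial (GraphVars n) ℂ)
    (q : Fin n × Fin n) :
    weightedHomogeneousComponent (gw n) 2 (g * generator n q) = C (coeff 0 g) * generator n q := by
  classical
  rw [weightedHomogeneousComponent_mul]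
  rw [Finset.sum_eq_single_of_mem ((0, 2) : ℕ × ℕ) (by simp)]
  · simp only [weightedHomogeneousComponent_generator, if_true]
    rw [weightedHomogeneousComponent_zero _ gw_ne_zero]
  · intro ij hij hne
    rw [Finset.HasAntidiagonal.mem_antidiagonal] at hij
    have h2 : ij.2 ≠ 2 := by
      intro h
      apply hne
      have h1 : ij.1 = 0 := by omega
      exact Prod.ext h1 h
    rw [weightedHomogeneousComponent_generator, if_neg h2, mul_zero]

/-- The `c_{q'}`-coefficient of `f_q` is `[q = q']`. -/
theorem coeff_inr_generator (q q' : Fin n × Fin n) :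
    coeff (Finsupp.single (Sum.inr q' : GraphVars n) 1) (generator n q) =
      if q = q' then 1 else 0 := by
  classical
  simp only [generator, coeff_sub, coeff_sum, coeff_X]
  have h0 : ∀ k : Fin n, coeff (Finsupp.single (Sum.inr q' : GraphVars n) 1)
      (X (Sum.inl (Sum.inl (q.1, k))) * X (Sum.inl (Sum.inr (k, q.2))) :
        MvPolynomial (GraphVars n) ℂ) = 0 := by
    intro k
    rw [coeff_X_mul']
    simp
  simp only [h0, Finset.sum_const_zero, sub_zero]
  by_cases h : q = q'
  · subst h; simp
  · rw [if_neg, if_neg h]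
    intro h'
    apply h
    have := Finsupp.single_left_injective (one_ne_zero) h'
    simpa using this

/-- **Weight-2 components of vanishing polynomials are linear in the generators**: for `t`
vanishing on `W_n`, `t_{(2)} = Σ_q (coefficient of c_q in t) · f_q`. -/
theorem weightedHomogeneousComponent_two_of_vanishing {t : MvPolynomial (GraphVars n) ℂ}
    (ht : ∀ y ∈ mmGraph n, eval y t = 0) :
    weightedHomogeneousComponent (gw n) 2 t =
      ∑ q : Fin n × Fin n, coeff (Finsupp.single (Sum.inr q : GraphVars n) 1) t • generator n q := by
  classical
  obtain ⟨g, hg⟩ := Ideal.mem_span_range_iff_exists_fun.mp (mem_span_generator_of_vanishing ht)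
  -- the component in terms of the (unknown) membership coefficients
  have h1 : weightedHomogeneousComponent (gw n) 2 t =
      ∑ q : Fin n × Fin n, C (coeff 0 (g q)) * generator n q := by
    rw [← hg, map_sum]
    exact Finset.sum_congr rfl fun q _ => weightedHomogeneousComponent_two_mul_generator _ _
  -- pin the coefficients by reading off the `c_q`-coefficients
  have h2 : ∀ q' : Fin n × Fin n,
      coeff (Finsupp.single (Sum.inr q' : GraphVars n) 1) t = coeff 0 (g q') := by
    intro q'
    have hw : coeff (Finsupp.single (Sum.inr q' : GraphVars n) 1)
        (weightedHomogeneousComponent (gw n) 2 t) =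
        coeff (Finsupp.single (Sum.inr q' : GraphVars n) 1) t := by
      rw [coeff_weightedHomogeneousComponent, if_pos]
      simp [Finsupp.weight_single, gw]
    rw [← hw, h1, coeff_sum]
    simp only [coeff_C_mul, coeff_inr_generator, mul_ite, mul_one, mul_zero]
    simp
  rw [h1]
  refine Finset.sum_congr rfl fun q _ => ?_
  rw [h2 q, smul_eq_C_mul]

/-! ## Reduced ⇒ pure isolated of order 2 -/

namespace EqSystem

/-- **A generically reduced system is pure isolated of order `2` at its reduced graph point**, with
the linear forms `P_o = Σ_q J_C(x)_{o,q} F_q`. -/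
theorem pureIsolatedAt_two_of_reducedAt {E : EqSystem n} (hE : E.Correct) {x : GraphVars n → ℂ}
    (hx : x ∈ mmGraph n) (hred : E.ReducedAt x) : E.PureIsolatedAt 2 x := by
  classical
  refine ⟨fun _ => 2, fun o => ∑ q : Fin n × Fin n, E.jacobianC x o q • X q, fun _ => le_rfl,
    fun o => ?_, fun F₀ hF => ?_⟩
  · have hv : ∀ y ∈ mmGraph n, eval y (bind₁ (shift x) (E.testPoly (E.tests.get o))) = 0 :=
      fun y hy => eval_bind₁_shift_eq_zero hx
        (fun z hz => hE.eval_testPoly_eq_zero hz (List.get_mem _ _)) hy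
    rw [weightedHomogeneousComponent_two_of_vanishing hv]
    simp only [map_sum, map_smul, aeval_X, coeff_inr_bind₁_shift]
    rfl
  · -- `J_C(x) · F₀ = 0` and `J_C(x)` has a left inverse
    have hJ : (E.jacobianC x).mulVec F₀ = 0 := by
      funext o
      have h := hF o
      simp only [map_sum, smul_eval, eval_X, Pi.zero_apply, mul_zero,
        Finset.sum_const_zero] at h
      simpa [Matrix.mulVec, dotProduct] using h
    obtain ⟨P, hP⟩ := leftInverse_of_rank_eq (E.jacobianC x) hred
    calc F₀ = (P * E.jacobianC x).mulVec F₀ := by rw [hP, Matrix.one_mulVec]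
      _ = P.mulVec ((E.jacobianC x).mulVec F₀) := by rw [Matrix.mulVec_mulVec]
      _ = 0 := by rw [hJ, Matrix.mulVec_zero]

/-- Generically reduced ⇒ pure isolated of order `2`. -/
theorem pureIsolated_two_of_genericallyReduced {E : EqSystem n} (hE : E.Correct)
    (h : E.GenericallyReduced) : E.PureIsolated 2 := by
  obtain ⟨x, hx, hred⟩ := h
  exact ⟨x, hx, pureIsolatedAt_two_of_reducedAt hE hx hred⟩

end EqSystem

/-! ## Admissibility and NEC corollaries -/

/-- `EqAdmissibleRed β → EqAdmissiblePure β`. -/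
theorem eqAdmissiblePure_of_red {β : ℝ} (h : EqAdmissibleRed β) : EqAdmissiblePure β := by
  obtain ⟨c, hc⟩ := h
  refine ⟨2, c, fun n hn => ?_⟩
  obtain ⟨E, hE, hred, hcost⟩ := hc n hn
  exact ⟨E, hE, EqSystem.pureIsolated_two_of_genericallyReduced hE hred, hcost⟩

/-- **`H_mult → Purification`** (the re-typed crux is implied by the original one). -/
theorem purification_of_multiplicityReduction (h : MultiplicityReduction) : Purification :=
  fun β hβ hE β' hβ' => eqAdmissiblePure_of_red (h β hβ hE β' hβ')

/-- **NEC: `S → Purification`.** -/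
theorem nec_purification (hS : _root_.MatrixMultiplication) : Purification :=
  purification_of_multiplicityReduction (nec_multiplicityReduction hS)

/-- Given `IsolatedForcesRank`, the re-typing is EXACT: `Purification ↔ H_mult`. -/
theorem purification_iff_multiplicityReduction (hJ : IsolatedForcesRank) :
    Purification ↔ MultiplicityReduction :=
  ⟨multiplicityReduction_of_purification hJ, purification_of_multiplicityReduction⟩

/-- Given `IsolatedForcesRank`, the split `S ↔ V ∧ Purification` is exact. -/
theorem matrixMultiplication_iff_quadratic_and_purification (hJ : IsolatedForcesRank) :
    _root_.MatrixMultiplication ↔ (GraphEquationsQuadratic ∧ Purification) :=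
  ⟨fun hS => ⟨nec_quadratic hS, nec_purification hS⟩,
    fun h => matrixMultiplication_of_quadratic_of_purification h.1 hJ h.2⟩

end Summit.MatrixMultiplication.MatrixMultiplication.Theorems.GraphEquations

end
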